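import Mathlib.GroupTheory.SpecificGroups.Alternating
import Literature.IUT.HodgeTheaters.GlobalFrobenioids
import HarnessLib

/-!
# [IUTchI] Example 5.1 (i), p. 124 l. 40 – p. 125 l. 22: κ-sol-conjugate synchronization — the typed
# predicate `NFBridgeRecon.KappaSolConjugateSynchronization` (FACT-LIST F-2574) read clause by clause
# against print, over INLINE group-theoretic binders (proof-only companion)

S. Mochizuki, *Inter-universal Teichmüller theory I*, kurims manuscript (May 2020), §5 Example 5.1 (i)
p. 124 l. 40 – p. 125 l. 22 ("although this poly-action of `𝔽_l^⋇` on `π₁^rat(†𝒟^⊛)` is only well-defined up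
to conjugation by elements of the subgroup `π₁^rat(†𝒟^⊚)` … it follows formally from the linear disjointness
property discussed in Remark 3.1.7, (iii), that, by regarding this poly-action of `𝔽_l^⋇` as arising from the
action of elements of `Aut^SL(†𝒟^⊚)`, … the resulting poly-action … is, in fact, well-defined up to
`π₁^{rat/κ-sol}(†𝒟^⊚)`-conjugacy indeterminacies, hence, in particular, that the induced poly-action on [the
domain, codomain, and arrow that constitute] the κ-sol-outer representation
`π₁^{κ-sol}(†𝒟^⊛) → Out^{κ-sol}(π₁^{rat/κ-sol}(†𝒟^⊛))` … is … equal to the trivial action") together with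
§3 Remark 3.1.7 (iii) p. 68 ("the subfields `L_C(C_K) ⊆ L̄_C ⊇ F(μ_l)·L_C(κ-sol)` are linearly disjoint over
`F(μ_l)·L_C`"), Remark 3.1.7 (iv) p. 69 ("`Gal(L̄_C/L_C(κ-sol))` is center-free") and §4 Example 4.3 (i) p. 99
(`Aut^SL_ε(C_K) ⊆ Aut^SL(C_K)` = the "semi-unipotent up to `±1`" inside the "Borel" subgroup of
`Im(G_{F_mod}) ⊆ GL₂(𝔽_l)/{±1}`) ([IUTchI] Ex 5.1 (i) p.124–125, Rmk 3.1.7 (iii)(iv) p.68–69, Ex 4.3 (i) p.99)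
[claim: Mochizuki2012, status: disputed].

PROOF-ONLY companion of abc-iut-L5-t1's `GlobalFrobenioids.lean` (FACT-LIST row F-2574, sub-DAG row
E51/L07): no `def`, no `instance`, no `structure`, no new `Prop` fact; every hypothesis is an INLINE binder on
the interface datum `N : NFBridgeRecon`.  Dictionary (genuine object ↔ interface): `Π := π₁^rat(†𝒟^⊛) = N.piRat`
(`= Gal(L̄_C/L_C)`), `Π° := π₁^rat(†𝒟^⊚) = N.ratCirc` (`= Gal(L̄_C/L_C(C_K))`), `K := π₁^{rat/κ-sol}(†𝒟^⊛) =
N.ratKsolKer` (`= Gal(L̄_C/L_C(κ-sol))`), `K° := K ∩ Π° = N.ratKsolCirc`, `Π^μ := Gal(L̄_C/F(μ_l)·L_C)` (a binder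
`PiMu`, `Π° ≤ Π^μ`), `M := K ∩ Π^μ = Gal(L̄_C/F(μ_l)·L_C(κ-sol))`.  Print's linear disjointness of Rmk 3.1.7 (iii) is,
in Galois-group form, `Π^μ = Π°·M` (binder `hLD : Π^μ ⊆ Π°·M` as sets); an element `a ∈ Aut^SL(†𝒟^⊚)` acts on `Π`
through conjugation by an element `c a ∈ Π^μ` lying over its image in `Gal(K/F(μ_l)) = Π^μ/Π°`, "only well-defined
up to `Π°`" (binder `hc : N.lift a = conj (c a)`).

## What is proved (elementary group theory; nothing of [IUTchI] is asserted or denied)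

* `exists_mem_ratKsolKer_lift_of_subset_mul` — under `hLD`, every `g ∈ Π^μ` has a representative `m ∈ M ⊆ K` of its
  `Π°`-coset (`m·g⁻¹ ∈ Π°`): the lifting CAN be chosen inside `π₁^{rat/κ-sol}(†𝒟^⊛)`;
* `mul_inv_mem_ratKsolCirc_of_lifts` — two such representatives of the SAME coset differ by an element of
  `K° = π₁^{rat/κ-sol}(†𝒟^⊚)`: print's "well-defined up to `π₁^{rat/κ-sol}(†𝒟^⊚)`-conjugacy indeterminacies";
* `kappaSolConjugateSynchronization_of_inner_lifts` — if every chosen lifting is INNER by an element of `K`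
  (`c a ∈ K`) then the clauses `map_ratKsolKer`, `trivial_on_quotient`, `inner_on_kernel` of the typed predicate hold
  (the "trivial action on the κ-sol-outer representation"), and the typed clause `indeterminacy` holds AS SOON AS
  liftings along an `Aut^SL_ε`-coset agree modulo `Π°` (`hcoset`);
* `not_kappaSolConjugateSynchronization_of_inner_lifts` — conversely, at ANY datum whose `Π` is centre-free and
  whose liftings are inner, the typed clause `indeterminacy` FORCES `c b·(c a)⁻¹ ∈ Π°` whenever `a⁻¹b ∈ Aut^SL_ε`:
  so if two members of one `Aut^SL_ε`-coset lift over DISTINCT classes mod `Π°` — which print asserts for the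
  genuine object (Ex 4.3 (i) p.99: the image of `Aut^SL_ε(C_K)` in `GL₂(𝔽_l)/{±1}` is the semi-unipotent-mod-`±1`
  subgroup, of order `l`, so `Aut^SL_ε(C_K)` is non-trivial, while `Aut(C_K) → Gal(K/F_mod) = π₁(†𝒟^⊛)/π₁(†𝒟^⊚)` is
  injective, `Aut_K(C_K)` being trivial for the `K`-core `C_K`, Def 3.1 (d)) — the typed predicate FAILS; variant
  `…_of_ratKsolKer_centerFree`
  uses only print's own centre-freeness of `Gal(L̄_C/L_C(κ-sol))` (Rmk 3.1.7 (iv)) with liftings in `K`;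
* `kappaSolConjugateSynchronization_iff_coset_agree` — at centre-free data with inner liftings in `K`, the typed
  predicate is EQUIVALENT to "liftings agree modulo `Π°` along `Aut^SL_ε`-cosets";
* `kappaSolConjugateSynchronization_of_lift_eq_self` — identity liftings (the landed `galoisModel`) satisfy the typed
  predicate (case `c := 1`); `exists_not_kappaSolConjugateSynchronization_of_inner_lifts` — a DEGENERATE finite toy
  (`𝔖₃ ⊳ 𝔄₃`, inner liftings, everything in `K`) at which the three "trivial action" clauses hold and the typed clause
  `indeterminacy` fails by the coset mechanism (a second refutation route for the universal closure of F-2574,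
  beside abc-iut-w4-d078's non-inner lifting in `FactListL5GlobalFrobenioidsSchemas.lean`).

READING (a typing observation for the tranche-188 row F-2574, no side taken): print's indeterminacy is the
`Π°`-orbit of liftings of ONE automorphism, reduced to a `K°`-orbit by linear disjointness; the typed clause
`indeterminacy` quantifies over two automorphisms `a, b` in one `Aut^SL_ε`-coset.  The theorems below show the two
readings part ways exactly at data where `Aut^SL_ε` acts with more than one Galois class — recorded for the L5
faithfulness lane; the FACT-LIST status of F-2574 (SCHEMA: `FactListL5GlobalFrobenioidsSchemas.lean`) is unchanged.
typed ≠ proved; instantiated ≠ endorsed; no side is taken on [IUTchIII] Cor. 3.12.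
-/

namespace Literature.IUT.HodgeTheaters

namespace NFBridgeRecon

open Pointwise

universe u

variable (N : NFBridgeRecon.{u})

/-! ### Linear disjointness (Rmk 3.1.7 (iii)) in Galois-group form: liftings can be chosen in `π₁^{rat/κ-sol}` -/

/-- **Liftings inside `π₁^{rat/κ-sol}(†𝒟^⊛)`.**  If `Π^μ ⊆ Π°·M` with `M := K ∩ Π^μ` (print's linear disjointness
of `L_C(C_K)` and `F(μ_l)·L_C(κ-sol)` over `F(μ_l)·L_C`, Rmk 3.1.7 (iii), in Galois-group form), then every
`g ∈ Π^μ` — e.g. any lifting of an element of `Aut^SL(†𝒟^⊚)`, which lies over `Gal(K/F(μ_l)) = Π^μ/Π°` — admits an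
`m ∈ K ∩ Π^μ` in the same `Π°`-coset: `m·g⁻¹ ∈ Π°`.
([IUTchI] Rmk 3.1.7 (iii) p.68, Ex 5.1 (i) p.124) [claim: Mochizuki2012, status: disputed] -/
theorem exists_mem_ratKsolKer_lift_of_subset_mul (PiMu : Subgroup N.piRat)
    (hLD : (PiMu : Set N.piRat) ⊆ (N.ratCirc : Set N.piRat) * ((N.ratKsolKer ⊓ PiMu : Subgroup N.piRat) : Set N.piRat))
    {g : N.piRat} (hg : g ∈ PiMu) :
    ∃ m : N.piRat, m ∈ N.ratKsolKer ∧ m ∈ PiMu ∧ m * g⁻¹ ∈ N.ratCirc := by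
  obtain ⟨h, hh, m, hm, rfl⟩ := hLD hg
  refine ⟨m, (Subgroup.mem_inf.1 hm).1, (Subgroup.mem_inf.1 hm).2, ?_⟩
  rw [mul_inv_rev, ← mul_assoc, mul_inv_cancel, one_mul]
  exact N.ratCirc.inv_mem hh

/-- **"Well-defined up to `π₁^{rat/κ-sol}(†𝒟^⊚)`-conjugacy indeterminacies."**  Two liftings `m, m' ∈ K` of the
same `Π°`-coset differ by an element of `K° = K ∩ Π° = π₁^{rat/κ-sol}(†𝒟^⊚)`: `m'·m⁻¹ ∈ N.ratKsolCirc`, and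
conjugation by `m'` is conjugation by `m` followed by conjugation by that element.
([IUTchI] Ex 5.1 (i) p.125 l.1–3) [claim: Mochizuki2012, status: disputed] -/
theorem mul_inv_mem_ratKsolCirc_of_lifts {g m m' : N.piRat} (hm : m ∈ N.ratKsolKer) (hm' : m' ∈ N.ratKsolKer)
    (hmg : m * g⁻¹ ∈ N.ratCirc) (hm'g : m' * g⁻¹ ∈ N.ratCirc) :
    m' * m⁻¹ ∈ N.ratKsolCirc ∧ ∀ x : N.piRat, m' * x * m'⁻¹ = (m' * m⁻¹) * (m * x * m⁻¹) * (m' * m⁻¹)⁻¹ := by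
  refine ⟨Subgroup.mem_inf.2 ⟨N.ratKsolKer.mul_mem hm' (N.ratKsolKer.inv_mem hm), ?_⟩, fun x => by group⟩
  have h : m' * m⁻¹ = (m' * g⁻¹) * (m * g⁻¹)⁻¹ := by group
  rw [h]
  exact N.ratCirc.mul_mem hm'g (N.ratCirc.inv_mem hmg)

/-! ### The typed predicate from inner liftings in `π₁^{rat/κ-sol}` -/

/-- **κ-sol-conjugate synchronization from inner liftings in `π₁^{rat/κ-sol}(†𝒟^⊛)`.**  If every chosen lifting
`N.lift a` (`a ∈ Aut^SL(†𝒟^⊚)`) is conjugation by some `c a ∈ K = π₁^{rat/κ-sol}(†𝒟^⊛)` — the choice print's linear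
disjointness permits, `exists_mem_ratKsolKer_lift_of_subset_mul` — then the liftings preserve `K`, act trivially
on `π₁^{κ-sol}(†𝒟^⊛) = Π/K` and restrict to inner automorphisms of `K` ("the induced poly-action on the κ-sol-outer
representation … is … equal to the trivial action"); and the typed clause `indeterminacy` holds provided liftings
along an `Aut^SL_ε`-coset agree modulo `Π°` (`hcoset`).  Elementary group theory over inline binders.
([IUTchI] Ex 5.1 (i) p.125 l.1–22) [claim: Mochizuki2012, status: disputed] -/
theorem kappaSolConjugateSynchronization_of_inner_lifts (c : N.AutSL → N.piRat)
    (hc : ∀ (a : N.AutSL) (g : N.piRat), N.lift a g = c a * g * (c a)⁻¹)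
    (hcK : ∀ a : N.AutSL, c a ∈ N.ratKsolKer)
    (hcoset : ∀ a b : N.AutSL, (a : N.AutD)⁻¹ * b ∈ N.AutSLε → c b * (c a)⁻¹ ∈ N.ratCirc) :
    N.KappaSolConjugateSynchronization where
  map_ratKsolKer a g := by
    rw [hc]
    constructor
    · intro hg
      exact N.ratKsolKer.mul_mem (N.ratKsolKer.mul_mem (hcK a) hg) (N.ratKsolKer.inv_mem (hcK a))
    · intro hg
      have h : g = (c a)⁻¹ * (c a * g * (c a)⁻¹) * (c a)⁻¹⁻¹ := by group
      rw [h]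
      exact N.ratKsolKer.mul_mem (N.ratKsolKer.mul_mem (N.ratKsolKer.inv_mem (hcK a)) hg)
        (N.ratKsolKer.inv_mem (N.ratKsolKer.inv_mem (hcK a)))
  indeterminacy a b hab := by
    refine ⟨c b * (c a)⁻¹, Subgroup.mem_inf.2 ⟨N.ratKsolKer.mul_mem (hcK b) (N.ratKsolKer.inv_mem (hcK a)),
      hcoset a b hab⟩, fun g => ?_⟩
    rw [hc, hc]
    group
  trivial_on_quotient a g := by
    rw [hc]
    have h : c a * g * (c a)⁻¹ * g⁻¹ = c a * (g * (c a)⁻¹ * g⁻¹) := by group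
    rw [h]
    exact N.ratKsolKer.mul_mem (hcK a) (N.ratKsolKer_normal.conj_mem _ (N.ratKsolKer.inv_mem (hcK a)) g)
  inner_on_kernel a := ⟨c a, hcK a, fun g _ => hc a g⟩

/-! ### The typed clause `indeterminacy` at centre-free data with inner liftings -/

/-- Group-theoretic core: if conjugation by `u` and by `v` agree on the whole group, then `v⁻¹·u` is central.
[folklore] -/
private theorem comm_of_conj_eq {G : Type*} [Group G] {u v : G} (h : ∀ x : G, u * x * u⁻¹ = v * x * v⁻¹)
    (x : G) : x * (v⁻¹ * u) = (v⁻¹ * u) * x := by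
  have h1 := h x
  calc x * (v⁻¹ * u) = v⁻¹ * (v * x * v⁻¹) * u := by group
    _ = v⁻¹ * (u * x * u⁻¹) * u := by rw [h1]
    _ = (v⁻¹ * u) * x := by group

/-- **The typed clause `indeterminacy` forces liftings along an `Aut^SL_ε`-coset to agree modulo `Π°`.**  At a datum
whose `Π = π₁^rat(†𝒟^⊛)` is centre-free and whose liftings are inner (`N.lift a = conj (c a)`), the typed
`KappaSolConjugateSynchronization` implies `c b·(c a)⁻¹ ∈ Π° = π₁^rat(†𝒟^⊚)` whenever `a⁻¹b ∈ Aut^SL_ε(†𝒟^⊚)`: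
from `conj (c b) = conj n ∘ conj (c a)` with `n ∈ K° ⊆ Π°` the element `(n·c a)⁻¹·c b` is central, hence trivial,
so `c b·(c a)⁻¹ = n ∈ Π°`.
([IUTchI] Ex 5.1 (i) p.125, Rmk 3.1.7 (iv) p.69) [claim: Mochizuki2012, status: disputed] -/
theorem coset_agree_of_kappaSolConjugateSynchronization
    (hZ : ∀ z : N.piRat, (∀ g : N.piRat, g * z = z * g) → z = 1)
    (c : N.AutSL → N.piRat) (hc : ∀ (a : N.AutSL) (g : N.piRat), N.lift a g = c a * g * (c a)⁻¹)
    (h : N.KappaSolConjugateSynchronization) {a b : N.AutSL} (hab : (a : N.AutD)⁻¹ * b ∈ N.AutSLε) :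
    c b * (c a)⁻¹ ∈ N.ratCirc := by
  obtain ⟨n, hn, hconj⟩ := h.indeterminacy a b hab
  have hconj' : ∀ x : N.piRat, c b * x * (c b)⁻¹ = (n * c a) * x * (n * c a)⁻¹ := fun x => by
    rw [← hc b x, hconj x, hc a x]
    group
  have hz : (n * c a)⁻¹ * c b = 1 := hZ _ (comm_of_conj_eq hconj')
  have hcb : c b * (c a)⁻¹ = n := by
    have h1 : c b = n * c a := by
      calc c b = (n * c a) * ((n * c a)⁻¹ * c b) := by group
        _ = n * c a := by rw [hz, mul_one]
    rw [h1, mul_assoc, mul_inv_cancel, mul_one]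
  rw [hcb]
  exact (Subgroup.mem_inf.1 hn).2

/-- **The typed F-2574 FAILS at centre-free, Galois-separated data.**  If `Π = π₁^rat(†𝒟^⊛)` is centre-free, the
liftings are inner, and some `a, b ∈ Aut^SL(†𝒟^⊚)` with `a⁻¹b ∈ Aut^SL_ε(†𝒟^⊚)` lift over DISTINCT classes modulo
`Π° = π₁^rat(†𝒟^⊚)` — as print asserts for the genuine object: `Aut^SL_ε(C_K)` is non-trivial (its image in
`GL₂(𝔽_l)/{±1}` is the semi-unipotent-mod-`±1` subgroup of order `l`, Ex 4.3 (i) p.99), `Aut(C_K) → Gal(K/F_mod) =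
π₁(†𝒟^⊛)/π₁(†𝒟^⊚)` is injective (`Aut_K(C_K) = 1` for the `K`-core `C_K`, Def 3.1 (d) p.62), and the liftings act
on `Π` over these Galois images — then `N.KappaSolConjugateSynchronization`
(as typed, clause `indeterminacy`) does NOT hold.  A statement about the TYPED clause at data described by inline
binders; nothing of print is denied (print's indeterminacy concerns the `Π°`-orbit of liftings of ONE
automorphism, cf. `mul_inv_mem_ratKsolCirc_of_lifts`).
([IUTchI] Ex 5.1 (i) p.124–125, Ex 4.3 (i) p.99) [claim: Mochizuki2012, status: disputed] -/
theorem not_kappaSolConjugateSynchronization_of_inner_lifts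
    (hZ : ∀ z : N.piRat, (∀ g : N.piRat, g * z = z * g) → z = 1)
    (c : N.AutSL → N.piRat) (hc : ∀ (a : N.AutSL) (g : N.piRat), N.lift a g = c a * g * (c a)⁻¹)
    {a b : N.AutSL} (hab : (a : N.AutD)⁻¹ * b ∈ N.AutSLε) (hsep : c b * (c a)⁻¹ ∉ N.ratCirc) :
    ¬ N.KappaSolConjugateSynchronization := fun h =>
  hsep (N.coset_agree_of_kappaSolConjugateSynchronization hZ c hc h hab)

/-- **Variant using only print's own centre-freeness of `Gal(L̄_C/L_C(κ-sol))`** (Rmk 3.1.7 (iv) p.69: "`Gal(L̄_C/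
L_C(κ-sol))` is center-free"): if the liftings are inner by elements of `K = π₁^{rat/κ-sol}(†𝒟^⊛)` (the choice
linear disjointness permits, `exists_mem_ratKsolKer_lift_of_subset_mul`) and `K` is centre-free, the typed clause
`indeterminacy` again forces `c b·(c a)⁻¹ ∈ Π°` along `Aut^SL_ε`-cosets; so Galois-separated members of one coset
refute the typed predicate.  Inline binders; a statement about the typed clause only.
([IUTchI] Rmk 3.1.7 (iv) p.69, Ex 5.1 (i) p.125) [claim: Mochizuki2012, status: disputed] -/
theorem not_kappaSolConjugateSynchronization_of_ratKsolKer_centerFree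
    (hZK : ∀ z ∈ N.ratKsolKer, (∀ g ∈ N.ratKsolKer, g * z = z * g) → z = 1)
    (c : N.AutSL → N.piRat) (hc : ∀ (a : N.AutSL) (g : N.piRat), N.lift a g = c a * g * (c a)⁻¹)
    (hcK : ∀ a : N.AutSL, c a ∈ N.ratKsolKer)
    {a b : N.AutSL} (hab : (a : N.AutD)⁻¹ * b ∈ N.AutSLε) (hsep : c b * (c a)⁻¹ ∉ N.ratCirc) :
    ¬ N.KappaSolConjugateSynchronization := by
  intro h
  obtain ⟨n, hn, hconj⟩ := h.indeterminacy a b hab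
  have hnK : n ∈ N.ratKsolKer := (Subgroup.mem_inf.1 hn).1
  have hconj' : ∀ x : N.piRat, c b * x * (c b)⁻¹ = (n * c a) * x * (n * c a)⁻¹ := fun x => by
    rw [← hc b x, hconj x, hc a x]
    group
  have hzK : (n * c a)⁻¹ * c b ∈ N.ratKsolKer :=
    N.ratKsolKer.mul_mem (N.ratKsolKer.inv_mem (N.ratKsolKer.mul_mem hnK (hcK a))) (hcK b)
  have hz : (n * c a)⁻¹ * c b = 1 := hZK _ hzK fun g _ => comm_of_conj_eq hconj' g
  have hcb : c b * (c a)⁻¹ = n := by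
    have h1 : c b = n * c a := by
      calc c b = (n * c a) * ((n * c a)⁻¹ * c b) := by group
        _ = n * c a := by rw [hz, mul_one]
    rw [h1, mul_assoc, mul_inv_cancel, mul_one]
  apply hsep
  rw [hcb]
  exact (Subgroup.mem_inf.1 hn).2

/-- **Characterisation.**  At a datum with centre-free `Π` and liftings inner by elements of `K = π₁^{rat/κ-sol}(†𝒟^⊛)`,
the typed `KappaSolConjugateSynchronization` holds IF AND ONLY IF liftings along every `Aut^SL_ε(†𝒟^⊚)`-coset
agree modulo `Π° = π₁^rat(†𝒟^⊚)` — the clause that separates the typed predicate from print's "well-defined up to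
`π₁^{rat/κ-sol}(†𝒟^⊚)`-conjugacy" (which concerns liftings of a single automorphism).
([IUTchI] Ex 5.1 (i) p.124–125) [claim: Mochizuki2012, status: disputed] -/
theorem kappaSolConjugateSynchronization_iff_coset_agree
    (hZ : ∀ z : N.piRat, (∀ g : N.piRat, g * z = z * g) → z = 1)
    (c : N.AutSL → N.piRat) (hc : ∀ (a : N.AutSL) (g : N.piRat), N.lift a g = c a * g * (c a)⁻¹)
    (hcK : ∀ a : N.AutSL, c a ∈ N.ratKsolKer) :
    N.KappaSolConjugateSynchronization ↔
      ∀ a b : N.AutSL, (a : N.AutD)⁻¹ * b ∈ N.AutSLε → c b * (c a)⁻¹ ∈ N.ratCirc :=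
  ⟨fun h _ _ hab => N.coset_agree_of_kappaSolConjugateSynchronization hZ c hc h hab,
    fun hcoset => N.kappaSolConjugateSynchronization_of_inner_lifts c hc hcK hcoset⟩

/-- **Identity liftings** (the landed Galois model `galoisModel F l`, all liftings `:= id`): the typed predicate
holds, as the case `c := 1` of `kappaSolConjugateSynchronization_of_inner_lifts` — recovers abc-iut-w4-d078's
`kappaSolConjugateSynchronization_galoisModel` generically.  SCHEMA evidence at degenerate liftings only.
([IUTchI] Ex 5.1 (i) p.125) [claim: Mochizuki2012, status: disputed] -/
theorem kappaSolConjugateSynchronization_of_lift_eq_self (hid : ∀ (a : N.AutSL) (g : N.piRat), N.lift a g = g) :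
    N.KappaSolConjugateSynchronization :=
  N.kappaSolConjugateSynchronization_of_inner_lifts (fun _ => 1) (fun a g => by rw [hid, one_mul, inv_one, mul_one])
    (fun _ => N.ratKsolKer.one_mem) fun _ _ _ => by
      rw [inv_one, mul_one]
      exact N.ratCirc.one_mem

/-! ### A finite toy exhibiting the coset mechanism (degenerate datum; SCHEMA evidence only) -/

/-- **The coset mechanism is not vacuous**: a DEGENERATE finite toy — `π₁^rat(†𝒟^⊛) = π₁(†𝒟^⊛) := 𝔖₃` (discrete,
centre-free) with `π₁(†𝒟^⊚) := 𝔄₃` (index `2`, playing "`Gal(K/F_mod)` of order `2`"), trivial actions on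
`𝕄̄^⊛ := K_rat := ℚ`, coric sets `ℚ ∖ {0}`, `solKer := ⊤` (so `π₁^{rat/κ-sol} = 𝔖₃`), Aut-data `Aut = Aut^SL =
Aut^SL_ε := 𝔖₃` with the INNER liftings `a ↦ conj a` — at which every lifting is inner by an element of
`π₁^{rat/κ-sol}` (so clauses `map_ratKsolKer`, `trivial_on_quotient`, `inner_on_kernel` hold by
`kappaSolConjugateSynchronization_of_inner_lifts`'s proof pattern) and yet the typed predicate FAILS, because the
transposition `(0 1)` and `1` lie in one `Aut^SL_ε`-coset but lift over distinct `𝔄₃`-cosets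
(`not_kappaSolConjugateSynchronization_of_inner_lifts`).  A second refutation mechanism for the universal closure of
F-2574 (abc-iut-w4-d078's `exists_not_kappaSolConjugateSynchronization` uses a NON-inner lifting instead); nothing
here is the genuine `π₁^rat(†𝒟^⊛)`; typed ≠ proved. ([IUTchI] Ex 5.1 (i) p.125) [claim: Mochizuki2012, status: disputed] -/
theorem exists_not_kappaSolConjugateSynchronization_of_inner_lifts :
    ∃ N : NFBridgeRecon.{0}, (∀ z : N.piRat, (∀ g : N.piRat, g * z = z * g) → z = 1) ∧
      (∃ c : N.AutSL → N.piRat, (∀ a, c a ∈ N.ratKsolKer) ∧ ∀ a g, N.lift a g = c a * g * (c a)⁻¹) ∧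
      ¬ N.KappaSolConjugateSynchronization := by
  let S := Equiv.Perm (Fin 3)
  letI : TopologicalSpace S := ⊥
  haveI : DiscreteTopology S := ⟨rfl⟩
  have hZS : ∀ z : S, (∀ g : S, g * z = z * g) → z = 1 := by decide
  have hsgn : Equiv.Perm.sign (Equiv.swap (0 : Fin 3) 1 * (1 : S)⁻¹) ≠ 1 := by
    rw [inv_one, mul_one, Equiv.Perm.sign_swap (by decide)]
    decide
  let G : ProfiniteGrp.{0} := ProfiniteGrp.of S
  letI act : MulSemiringAction G ℚ := MulSemiringAction.compHom ℚ (1 : G →* RingAut ℚ)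
  have hsmul : ∀ (g : G) (f : ℚ), g • f = f := fun _ _ => rfl
  let ι : S → (G ≃ₜ* G) := fun s =>
    { MulAut.conj s with
      continuous_toFun := continuous_of_discreteTopology
      continuous_invFun := continuous_of_discreteTopology }
  let N : NFBridgeRecon.{0} :=
    { l := 5
      piDast := G
      piDcirc := ⟨alternatingGroup (Fin 3), isOpen_discrete _⟩
      Fbar := ℚ
      fbarField := inferInstance
      fbarAction := act
      isOpen_stabilizer_fbar := fun _ => isOpen_discrete _
      piRat := G
      ratToAst := ContinuousMonoidHom.id G
      ratToAst_surjective := Function.surjective_id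
      Krat := ℚ
      kratField := inferInstance
      kratAction := act
      isOpen_stabilizer_krat := fun _ => isOpen_discrete _
      const := RingHom.id ℚ
      const_smul := fun _ _ => rfl
      Mκ := {f | f ≠ 0}
      Minfκ := {f | f ≠ 0}
      Minfκx := {f | f ≠ 0}
      mκ_subset := subset_rfl
      minfκ_subset := subset_rfl
      zero_notMem := fun h => h rfl
      smul_mem_minfκ := fun g f hf => by
        change g • f ≠ 0
        rw [hsmul]
        exact hf
      smul_mem_minfκx := fun g f hf => by
        change g • f ≠ 0
        rw [hsmul]
        exact hf
      solKer := ⊤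
      solKer_normal := inferInstance
      AutD := S
      autGroup := inferInstance
      Autε := ⊤
      AutSL := ⊤
      AutSLε := ⊤
      autSLε_le := le_rfl
      autSLε_le_autε := le_rfl
      lift := fun a => ι a }
  have hK : ∀ g : N.piRat, g ∈ N.ratKsolKer := fun g =>
    Subgroup.mem_inf.2 ⟨fun f _ => hsmul g f, Subgroup.mem_top _⟩
  refine ⟨N, fun z hz => hZS z hz, ⟨fun a => (a : S), fun a => hK _, fun a g => rfl⟩, ?_⟩
  refine N.not_kappaSolConjugateSynchronization_of_inner_lifts (fun z hz => hZS z hz) (fun a => (a : S))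
    (fun a g => rfl) (a := 1) (b := ⟨Equiv.swap (0 : Fin 3) 1, Subgroup.mem_top _⟩) (Subgroup.mem_top _) ?_
  intro h
  exact hsgn (Equiv.Perm.mem_alternatingGroup.1 h)

end NFBridgeRecon

end Literature.IUT.HodgeTheaters
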